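import Literature.MathematicalPhysics.QuantumFieldTheory.Balaban1983to89.B9Thm311ReadingCoords
import Literature.MathematicalPhysics.QuantumFieldTheory.Balaban1983to89.B9Thm37CubeCoverCommutators
import Literature.Analysis.InnerProduct.KyFanTwoSmallest

/-!
# `Balaban1983to89.B9Thm311PosDefViaSpectralGap` — T. Bałaban, *Propagators for lattice gauge theories in a background field*, Commun. Math. Phys. **99**
# (1985) 389–434 [Balaban1985BackgroundPropagators], Thm 3.11 p. 416 («the operators Δ′_a, G′, (Q′G′²Q′\*)⁻¹, Δ_a, G are positive definite»): THE SPECTRAL-GAP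
# ENGINE — a symmetric operator that is bounded below by `−ε` as a form AND invertible with every eigenvalue of modulus `≥ 1∕K`, `εK < 1`, is POSITIVE
# DEFINITE; in the N06 knit's currency `PosDefTr ∕ IsSymmTr ∕ trIP` of def-Y's letters (cell `pub-ymgap`, seat `dag-n06-j` gen 31; row 17's road from
# Theorem 3.3's bounds on `G = Δ_a⁻¹` plus the (3.69) smallness of the curvature part of the Hessian)

statement-level skeleton of published theorems with citation tags; proofs where landed; nothing here is a claim about the Yang–Mills mass gap

THE PRINT.  Thm 3.11 p. 416 (positivity of `Δ_a`), proved there through (3.105) `Δ_aG₀ = I − R`; Thm 3.3 p. 399 (`G = Δ_a⁻¹` satisfies (3.42)); p. 392 after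
(3.10) («the operator Δ′ will be a bounded, small operator … a small perturbation of D\*D»); (3.69) p. 404.

WHY THIS FILE (cell context).  Row 17 of the N06 certificate displays `PosDefTr 1 (deltaAY … U)` on print's class (this lineage's `t311_of_pins_opsYOfLettersV4₁`,
the located clause `hΔA`; since ED.58 routed through `hGsqA`).  This lineage has (a) `Δ_a(U) ≥ Δ(U)` as forms (g7 `B9Thm311ProjectionR.trIP_hessY_le_trIP_deltaAY`),
(b) the (3.69) lower bound of the Hessian `Δ(U)` by `−O(Mα₀)`-weighted forms (g11 `B9Thm311PosOfPrincipalAtLettersY.trIP_hessY_ge`), and — since today — (c)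
Theorem 3.3's (3.42) block for `G = Δ_a⁻¹` at section-carrying members from cell `lit-balaban`'s assembler (`B9Thm310DeltaAIsUnitOfRegYP335AtLettersY`).  (c)
bounds every eigenvalue of the (weighted) `Δ_a` AWAY from zero, (a)+(b) bound the form from BELOW by a small negative multiple of the weight; THIS FILE is the
abstract step that turns the two into positive definiteness: no eigenvalue can sit in `[−ε, 0]` when `|λ| ≥ 1∕K > ε`, and a symmetric operator with positive
spectrum is positive definite (spectral theorem, Mathlib's `LinearMap.IsSymmetric.eigenvectorBasis`; the Rayleigh expansion is the tree's
`Literature.Analysis.InnerProduct.inner_apply_self_eq_sum_eigenvalues`, imported BY NAME).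

WHAT IS PROVED (sorry-free; 0 `def`; pure finite-dimensional linear algebra).
* §1 (a finite-dimensional real inner product space `V`, `T : V →ₗ[ℝ] V` symmetric): `posDef_of_isSymmetric_of_eigenvalues_pos` (all eigenvalues of
  eigenvectors positive ⇒ `B9Thm311Data.PosDef T`), `eigenvalue_pos_of_form_ge_of_abs_ge` (the arithmetic: `λ ≥ −ε`, `|λ| ≥ K⁻¹`, `εK < 1` ⇒ `0 < λ`),
  ★★ `posDef_of_isSymmetric_of_form_ge_of_eigen_abs_ge`.
* §2 (def-Y's genuine currency on `S → M_n(ℂ)` with the weighted trace pairing `trIP w`): ★★★ `posDefTr_of_isSymmTr_of_form_ge_of_eigen_abs_ge` — `IsSymmTr w T`,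
  `∀ Φ, −ε·⟨Φ,Φ⟩_w ≤ ⟨Φ, TΦ⟩_w`, every real eigenvalue `μ` of `T` (`TΦ = μ•Φ`, `Φ ≠ 0`) has `K⁻¹ ≤ |μ|`, `0 < K`, `εK < 1` ⟹ `PosDefTr w T`
  (transport by `realify311`, n06-j g5∕g7's orthonormal chart).
* §3 the weight congruence with the tree's multiplication letter `cutMulY` (`B9Thm37CubeCoverCommutators`): `cutMulY_cutMulY_fun`, `cutMulY_constOne`,
  `trIP_cutMulY_left` (self-adjoint for every `trIP w`), ★ `posDefTr_of_posDefTr_conj_cutMulY` (`PosDefTr w (M_ρ ∘ T ∘ M_ρ)`, `ρ` nowhere zero ⇒ `PosDefTr w T`).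
HONEST SCOPE.  Linear algebra only; nothing of [B9] asserted; the inputs (form bound, eigenvalue bound) are hypotheses here and theorems in the companion
files; NOT a node discharge; count-neutral; nothing continuum ∕ OS ∕ mass gap ∕ Clay.  Cell `pub-ymgap` (HUMAN RULING D-0062), node N06 [B9], seat
`pub-ymgap-dag-n06-j` (harness re-seat gen 31), 2026-08-29.  No `sorry`, no `axiom`, no `instance`, no `notation`, no `def`.
-/

noncomputable section

namespace Literature.MathematicalPhysics.QuantumFieldTheory.Balaban1983to89.B9Thm311PosDefViaSpectralGap

open Literature.MathematicalPhysics.QuantumFieldTheory.Balaban1983to89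
open B9Thm311ReadingCoords
open scoped InnerProductSpace

/-! ## §1 The abstract engine on a finite-dimensional real inner product space -/

section Abstract

variable {V : Type*} [NormedAddCommGroup V] [InnerProductSpace ℝ V] [FiniteDimensional ℝ V] {T : V →ₗ[ℝ] V}

/-- **a symmetric operator all of whose eigenvalues (at eigenvectors) are positive is positive definite** (spectral theorem: expand in Mathlib's orthonormal
eigenvector basis; Rayleigh expansion by name from `Literature.Analysis.InnerProduct`). [cite: Balaban1985BackgroundPropagators, Thm 3.11 p.416 («symmetric … positive definite»), bookkeeping] -/
theorem posDef_of_isSymmetric_of_eigenvalues_pos (hT : T.IsSymmetric) (hpos : ∀ (μ : ℝ) (v : V), v ≠ 0 → T v = μ • v → 0 < μ) :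
    B9Thm311Data.PosDef T := by
  intro x hx
  obtain ⟨d, hd⟩ : ∃ d, Module.finrank ℝ V = d := ⟨_, rfl⟩
  have hexp := Literature.Analysis.InnerProduct.inner_apply_self_eq_sum_eigenvalues hT hd x
  have hlam : ∀ i, 0 < hT.eigenvalues hd i := by
    intro i
    refine hpos _ _ ((hT.eigenvectorBasis hd).orthonormal.ne_zero i) ?_
    have h := hT.apply_eigenvectorBasis hd i
    simpa only [RCLike.ofReal_real_eq_id, id_eq] using h
  have hpar : ∑ i, ⟪hT.eigenvectorBasis hd i, x⟫_ℝ ^ 2 = ‖x‖ ^ 2 := (hT.eigenvectorBasis hd).sum_sq_inner_right x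
  have hnorm : 0 < ‖x‖ ^ 2 := by positivity
  -- some coefficient is nonzero
  have hex : ∃ i, 0 < ⟪hT.eigenvectorBasis hd i, x⟫_ℝ ^ 2 := by
    by_contra hno
    push Not at hno
    have : ∑ i, ⟪hT.eigenvectorBasis hd i, x⟫_ℝ ^ 2 ≤ 0 := Finset.sum_nonpos fun i _ => hno i
    linarith
  obtain ⟨i₀, hi₀⟩ := hex
  rw [real_inner_comm, hexp]
  refine lt_of_lt_of_le (mul_pos (hlam i₀) hi₀) ?_
  rw [← Finset.sum_erase_add _ _ (Finset.mem_univ i₀)]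
  have hrest : 0 ≤ ∑ i ∈ Finset.univ.erase i₀, hT.eigenvalues hd i * ⟪hT.eigenvectorBasis hd i, x⟫_ℝ ^ 2 :=
    Finset.sum_nonneg fun i _ => mul_nonneg (hlam i).le (sq_nonneg _)
  linarith

/-- the arithmetic of the gap: `−ε ≤ μ`, `K⁻¹ ≤ |μ|`, `0 < K`, `εK < 1` ⇒ `0 < μ`. [cite: Balaban1985BackgroundPropagators, Thm 3.11 p.416, bookkeeping] -/
theorem eigenvalue_pos_of_form_ge_of_abs_ge {ε K μ : ℝ} (hK : 0 < K) (hεK : ε * K < 1) (hform : -ε ≤ μ) (habs : K⁻¹ ≤ |μ|) : 0 < μ := by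
  by_contra hle
  push Not at hle
  have h1 : |μ| = -μ := abs_of_nonpos hle
  rw [h1] at habs
  have h2 : K⁻¹ ≤ ε := by linarith
  have h3 : 1 ≤ ε * K := by
    have := mul_le_mul_of_nonneg_right h2 hK.le
    rwa [inv_mul_cancel₀ hK.ne'] at this
  linarith

/-- ★★ **THE SPECTRAL-GAP ENGINE**: a symmetric `T` with `⟨v, Tv⟩ ≥ −ε‖v‖²` whose eigenvalues all have modulus `≥ K⁻¹`, `0 < K`, `εK < 1`, is positive definite.
[cite: Balaban1985BackgroundPropagators, Thm 3.11 p.416; Thm 3.3 p.399] -/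
theorem posDef_of_isSymmetric_of_form_ge_of_eigen_abs_ge (hT : T.IsSymmetric) {ε K : ℝ} (hK : 0 < K) (hεK : ε * K < 1)
    (hform : ∀ v : V, -ε * ‖v‖ ^ 2 ≤ ⟪v, T v⟫_ℝ) (heig : ∀ (μ : ℝ) (v : V), v ≠ 0 → T v = μ • v → K⁻¹ ≤ |μ|) :
    B9Thm311Data.PosDef T := by
  refine posDef_of_isSymmetric_of_eigenvalues_pos hT fun μ v hv hTv => ?_
  refine eigenvalue_pos_of_form_ge_of_abs_ge hK hεK ?_ (heig μ v hv hTv)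
  have h := hform v
  rw [hTv, real_inner_smul_right, real_inner_self_eq_norm_sq] at h
  have hn : 0 < ‖v‖ ^ 2 := by positivity
  nlinarith

end Abstract

/-! ## §2 In def-Y's genuine currency: `PosDefTr w T` from `IsSymmTr w T`, a form bound and an eigenvalue bound -/

section Genuine

variable {S n : Type} [Fintype S] [Fintype n]
variable {w : S → ℝ}

/-- ★★★ **THE ENGINE AT def-Y's LETTERS**: for a `ℂ`-linear operator `T` on `S → M_n(ℂ)`, symmetric for the weighted trace pairing `⟨·,·⟩_w`, with
`⟨Φ, TΦ⟩_w ≥ −ε⟨Φ, Φ⟩_w` and every real eigenvalue of modulus `≥ K⁻¹` (`0 < K`, `εK < 1`): `PosDefTr w T`. [cite: Balaban1985BackgroundPropagators, Thm 3.11 p.416; Thm 3.3 p.399] -/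
theorem posDefTr_of_isSymmTr_of_form_ge_of_eigen_abs_ge (hw : ∀ s, 0 < w s) (T : (S → Matrix n n ℂ) →ₗ[ℂ] (S → Matrix n n ℂ)) (hT : IsSymmTr w T)
    {ε K : ℝ} (hK : 0 < K) (hεK : ε * K < 1) (hform : ∀ Φ, -ε * trIP w Φ Φ ≤ trIP w Φ (T Φ))
    (heig : ∀ (μ : ℝ) (Φ : S → Matrix n n ℂ), Φ ≠ 0 → T Φ = (μ : ℂ) • Φ → K⁻¹ ≤ |μ|) : PosDefTr w T := by
  rw [← posDef_conj311_realify311_iff (hw := hw)]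
  have hsymm : (conj311 (realify311 w hw) (realify311 w hw) T).IsSymmetric := by
    intro u v
    exact (symm_conj311_realify311_iff (hw := hw) T).2 hT u v
  refine posDef_of_isSymmetric_of_form_ge_of_eigen_abs_ge hsymm hK hεK (fun v => ?_) (fun μ v hv hTv => ?_)
  · have h := hform ((realify311 w hw).symm v)
    have e1 : ⟪v, conj311 (realify311 w hw) (realify311 w hw) T v⟫_ℝ = trIP w ((realify311 w hw).symm v) (T ((realify311 w hw).symm v)) := by
      rw [conj311_apply, ← inner_realify311 (hw := hw), LinearEquiv.apply_symm_apply]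
    have e2 : ‖v‖ ^ 2 = trIP w ((realify311 w hw).symm v) ((realify311 w hw).symm v) := by
      rw [← norm_sq_realify311 (hw := hw), LinearEquiv.apply_symm_apply]
    rw [e1, e2]; exact h
  · have hΦ : (realify311 w hw).symm v ≠ 0 := fun h0 => hv (by simpa using congrArg (realify311 w hw) h0)
    refine heig μ _ hΦ ?_
    have h1 : realify311 w hw (T ((realify311 w hw).symm v)) = μ • v := by rw [← conj311_apply]; exact hTv
    have h2 : T ((realify311 w hw).symm v) = (realify311 w hw).symm (μ • v) := by
      rw [← h1, LinearEquiv.symm_apply_apply]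
    rw [h2, LinearEquiv.map_smul, Complex.coe_smul]

end Genuine

/-! ## §3 The weight congruence: pointwise real scaling (`cutMulY`, the tree's multiplication letter) is self-adjoint for every weighted trace pairing -/

section Weight

open scoped Matrix.Norms.L2Operator
open Literature.MathematicalPhysics.QuantumFieldTheory.Balaban1983to89.B9Thm37CubeCoverCommutators (cutMulY cutMulY_apply)

variable {S : Type} {N : ℕ}

/-- `M_r ∘ M_{r′} = M_{r·r′}` for the tree's multiplication letter `cutMulY` on `M_N(ℂ)`-valued functions. [cite: Balaban1985BackgroundPropagators, (3.41) p.397 (weights), bookkeeping] -/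
theorem cutMulY_cutMulY_fun (r r' : S → ℝ) (Φ : S → Matrix (Fin N) (Fin N) ℂ) :
    cutMulY r (cutMulY r' Φ) = cutMulY (fun s => r s * r' s) Φ := by
  funext s; simp only [cutMulY_apply, smul_smul, Complex.ofReal_mul]

/-- `M_1 = id`. [cite: Balaban1985BackgroundPropagators, (3.41) p.397, bookkeeping] -/
theorem cutMulY_constOne (Φ : S → Matrix (Fin N) (Fin N) ℂ) : cutMulY (fun _ : S => (1 : ℝ)) Φ = Φ := by
  funext s; simp only [cutMulY_apply, Complex.ofReal_one, one_smul]

variable [Fintype S]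

/-- `M_r` is self-adjoint for every weighted trace pairing: `⟨M_rΦ, Ψ⟩_w = ⟨Φ, M_rΨ⟩_w`. [cite: Balaban1985BackgroundPropagators, p.393 (scalar products), bookkeeping] -/
theorem trIP_cutMulY_left (w r : S → ℝ) (Φ Ψ : S → Matrix (Fin N) (Fin N) ℂ) : trIP w (cutMulY r Φ) Ψ = trIP w Φ (cutMulY r Ψ) := by
  unfold trIP
  refine Finset.sum_congr rfl fun s _ => ?_
  congr 1
  refine Finset.sum_congr rfl fun a _ => Finset.sum_congr rfl fun b _ => ?_
  simp only [cutMulY_apply, Matrix.smul_apply, smul_eq_mul, star_mul', Complex.star_def, Complex.conj_ofReal]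
  ring_nf

/-- ★ **POSITIVITY IS INVARIANT UNDER THE WEIGHT CONGRUENCE**: if `M_ρ ∘ T ∘ M_ρ` is positive definite for `⟨·,·⟩_w` and `ρ` vanishes nowhere, then so is `T`
(`Φ = M_ρΨ` with `Ψ = M_{ρ⁻¹}Φ ≠ 0`). [cite: Balaban1985BackgroundPropagators, Thm 3.11 p.416, bookkeeping] -/
theorem posDefTr_of_posDefTr_conj_cutMulY {w : S → ℝ} (ρ : S → ℝ) (hρ : ∀ s, ρ s ≠ 0)
    (T : (S → Matrix (Fin N) (Fin N) ℂ) →ₗ[ℂ] (S → Matrix (Fin N) (Fin N) ℂ))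
    (h : PosDefTr w (cutMulY ρ ∘ₗ T ∘ₗ cutMulY ρ)) : PosDefTr w T := by
  intro Φ hΦ
  set Ψ := cutMulY (fun s => (ρ s)⁻¹) Φ with hΨ
  have hΦΨ : cutMulY ρ Ψ = Φ := by
    rw [hΨ, cutMulY_cutMulY_fun]
    have : (fun s => ρ s * (ρ s)⁻¹) = fun _ => (1 : ℝ) := funext fun s => mul_inv_cancel₀ (hρ s)
    rw [this, cutMulY_constOne]
  have hΨ0 : Ψ ≠ 0 := by
    intro h0; apply hΦ; rw [← hΦΨ, h0, map_zero]
  have := h Ψ hΨ0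
  rw [LinearMap.comp_apply, LinearMap.comp_apply, ← trIP_cutMulY_left, hΦΨ] at this
  exact this

end Weight

end Literature.MathematicalPhysics.QuantumFieldTheory.Balaban1983to89.B9Thm311PosDefViaSpectralGap

end
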